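import Literature.MathematicalPhysics.QuantumLattice.HubbardInteractionMoments
import HarnessLib

/-!
# Moments of the Hubbard interaction with two external fields: the two-point numerator at finite cutoff and its limit

Topic `MathematicalPhysics/QuantumLattice`; the two-point analogue of `HubbardInteractionMoments` in the `M → ∞`
("Matsubara UV") bridge.  BGM 2006 (2.8): the Schwinger function is the ratio of the Grassmann integrals
`∫P(dψ) e^{-V} ψ⁻_𝐱 ψ⁺_𝐲` and `∫P(dψ) e^{-V}`; expanding `e^{-V}` the numerator needs the moments
`∫dμ_{C_M} ψ⁺_{(x⃗ₑ,sₓ)σ} ψ⁻_{(y⃗ₑ,s_y)σ'} Vⁿ`.  Since `linearMap_apply_hubbardInteraction_pow` holds for EVERY linear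
functional, it applies to `F ↦ ∫dμ_C (ψ⁺ψ⁻ · F)`; the external fields are the position–time fields of two extra points
appended to the vertex configuration (`Fin.append x⃗ ![x⃗ₑ, y⃗ₑ]`, `Fin.append τ ![sₓ, s_y]`), so that ONE substitution
matrix carries all fields and the determinant Wick rule applies with independent enumerations of the barred and
unbarred legs:

* `positionField β c σ y s = Σ_k (βL²)⁻¹ conj(e^{-is_c k·(y,s)}) ψ̂^c_{kσ}` (BGM (2.5)); `map_vertexSub_gen_eq_positionField`;
  `vertexFieldWord_congr` (the vertex word depends only on its own point), `prod_vertexFieldWord_comp_eq_map_genPairProd`;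
* `gaussExpect_vertexWord_eq_det` — Wick's rule `∫dμ_{C_M} Πᵢ ψ⁺_{P i} ψ⁻_{Q i} = det[−(SᵀC_MS)((P i,+),(Q j,−))]` for
  INDEPENDENT pair enumerations `P, Q`;
* `twoPointPlus/MinusEnum` — the enumerations of the `2n+1` pairs of `ψ⁺_{xₑσ}ψ⁻_{yₑσ'} Π_a(vertex a)`;
* **`gaussExpect_twoPoint_mul_hubbardInteraction_pow_eq_det`** —
  `∫dμ_{C_M} ψ⁺_{(x⃗ₑ,sₓ)σ}ψ⁻_{(y⃗ₑ,s_y)σ'} Vⁿ = Uⁿ Σ_{x⃗} ∫_{[0,β]ⁿ} det[−(S'ᵀC_MS')((P⁺ i,+),(P⁻ j,−))]_{i,j ≤ 2n} dτ`;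
* **`tendsto_gaussExpect_twoPoint_mul_hubbardInteraction_pow`** — for external times `sₓ, s_y ∈ [0, β)` the `n`-th
  two-point moment converges as `M → ∞` to `Uⁿ Σ_{x⃗} ∫_{[0,β]ⁿ} det[vertexLimitEntry …]` (all time differences of the
  `n + 2` points have modulus `< β` off the faces of the cube, so `tendsto_vertexWickEntry` applies entrywise).

The sum over `n`, and the identification with `Tr(e^{-βH} c†c)` (shifted chemical potential, midpoint `½` at equal
external times) are NOT here.

## Sources

G. Benfatto, A. Giuliani, V. Mastropietro, Ann. Henri Poincaré 7 (2006) 809–898 = arXiv:cond-mat/0507686, §1.2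
(1.2)–(1.4), §2.1 (2.5)–(2.8) [`BenfattoGiulianiMastropietro2006`].
-/

noncomputable section

namespace Literature.MathematicalPhysics.QuantumLattice

open GrassmannAlgebra Finset Filter _root_.MeasureTheory Literature.Probability.LatticeModels _root_.Topology
open scoped ComplexConjugate

/-! ### Position–time fields and the locality of the vertex word -/

section Fields

variable (L M : ℕ) [NeZero L]

/-- **The position–time field** `ψ^c_{(y⃗,s)σ} = Σ_k (βL²)⁻¹ conj(e^{-is_c k·(y⃗,s)}) ψ̂^c_{kσ}` of charge `c`, spin `σ`
at the space–time point `(y⃗, s)` (BGM 2006, (2.5)); the image of a leg generator under ANY vertex-field substitution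
whose configuration contains the point `(y⃗, s)`. [cite: BenfattoGiulianiMastropietro2006, §2.1 (2.5)] -/
def positionField (β : ℝ) (c σ : Fin 2) (y : TorusSite 2 L) (s : ℝ) : HubbardGrassmann L M :=
  ∑ k : FreqMomentum L M, ((((1 / (β * (L : ℝ) ^ 2) : ℝ) : ℂ) * conj (vertexPlaneWave L M β c k y s))) •
    gen ℂ (((k, σ), c) : HubbardFieldIdx L M)

variable {L M}

/-- The vertex-field substitution realises the position–time fields:
`map (toLin' S_{x⃗,τ}) (gen ((a,σ),c)) = positionField β c σ (x⃗_a) (τ_a)`. [cite: BenfattoGiulianiMastropietro2006, §2.1 (2.5)] -/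
theorem map_vertexSub_gen_eq_positionField (β : ℝ) {n : ℕ} (x : Fin n → TorusSite 2 L) (τ : Fin n → ℝ)
    (a : Fin n) (σ c : Fin 2) :
    ExteriorAlgebra.map (Matrix.toLin' (vertexSubMatrix L M β x τ)) (gen ℂ (((a, σ), c) : VertexLeg n)) =
      positionField L M β c σ (x a) (τ a) := by
  rw [positionField]
  exact map_vertexSub_gen β x τ ((a, σ), c)

/-- **Locality of the vertex word**: it depends only on its own space–time point. [folklore] -/
theorem vertexFieldWord_congr (β : ℝ) {n n' : ℕ} {x : Fin n → TorusSite 2 L} {τ : Fin n → ℝ}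
    {x' : Fin n' → TorusSite 2 L} {τ' : Fin n' → ℝ} {a : Fin n} {a' : Fin n'} (hx : x a = x' a') (hτ : τ a = τ' a') :
    vertexFieldWord L M β x τ a = vertexFieldWord L M β x' τ' a' := by
  rw [vertexFieldWord_eq_sum, vertexFieldWord_eq_sum, hx, hτ]

omit [NeZero L] in
/-- The product of the vertex words along any relabelling `e` of the vertices is the image of the paired monomial
with the relabelled standard enumeration. [folklore] -/
theorem prod_vertexFieldWord_comp_eq_map_genPairProd (β : ℝ) {n n' : ℕ} (x : Fin n' → TorusSite 2 L)
    (τ : Fin n' → ℝ) (e : Fin n → Fin n') :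
    (List.ofFn fun a => vertexFieldWord L M β x τ (e a)).prod =
      ExteriorAlgebra.map (Matrix.toLin' (vertexSubMatrix L M β x τ))
        (genPairProd ℂ
          (fun i : Fin (n * 2) => (((e (finProdFinEquiv.symm i : Fin n × Fin 2).1,
            (finProdFinEquiv.symm i : Fin n × Fin 2).2), 0) : VertexLeg n'))
          (fun i : Fin (n * 2) => (((e (finProdFinEquiv.symm i : Fin n × Fin 2).1,
            (finProdFinEquiv.symm i : Fin n × Fin 2).2), 1) : VertexLeg n'))) := by
  rw [genPairProd, map_list_prod, List.map_ofFn, prod_ofFn_mul_two]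
  congr 1
  refine List.ofFn_inj.2 (funext fun a => ?_)
  simp only [Function.comp_apply, Equiv.symm_apply_apply, map_mul, vertexFieldWord, mul_assoc]

end Fields

/-! ### Wick's rule with independent enumerations of barred and unbarred legs -/

section Wick

variable {L M : ℕ} [NeZero L]

/-- **Wick's rule for a product of `ψ⁺ψ⁻` pairs with independent enumerations**:
`∫dμ_{C_M} Πᵢ ψ⁺_{P i} ψ⁻_{Q i} = det[−(SᵀC_MS)((P i,+),(Q j,−))]_{i,j}` (`ψ⁺` legs do not contract among themselves).
[cite: BenfattoGiulianiMastropietro2006, §2.1 (2.6)-(2.8)] -/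
theorem gaussExpect_vertexWord_eq_det (β μ : ℝ) {n m : ℕ} (x : Fin n → TorusSite 2 L) (τ : Fin n → ℝ)
    (P Q : Fin m → Fin n × Fin 2) :
    gaussExpect ℂ (hubbardCovariance L M β μ 0)
        (ExteriorAlgebra.map (Matrix.toLin' (vertexSubMatrix L M β x τ))
          (genPairProd ℂ (fun i => ((P i, 0) : VertexLeg n)) (fun i => ((Q i, 1) : VertexLeg n)))) =
      (Matrix.of fun i j => -((vertexSubMatrix L M β x τ).transpose * hubbardCovariance L M β μ 0 *
        vertexSubMatrix L M β x τ) ((P i, 0) : VertexLeg n) ((Q j, 1) : VertexLeg n)).det := by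
  rw [gaussExpect_map_toLin', hubbardCovariance_zero_seed]
  rw [gaussExpect_genPairProd]
  · congr 1
    ext i j
    simp only [Matrix.of_apply]
    obtain ⟨a, σ⟩ := P i
    obtain ⟨b, σ'⟩ := Q j
    exact contr_vertexSub_pullback_zero_one β x τ _ a b σ σ'
  · intro i j
    exact contr_vertexSub_pullback_of_charge_eq β x τ _ rfl

end Wick

/-! ### The two-point moments -/

section TwoPoint

variable {L : ℕ} [NeZero L]

/-- The enumeration of the BARRED legs of `ψ⁺_{(x⃗ₑ,sₓ)σ} ψ⁻_{(y⃗ₑ,s_y)σ'} Π_a ψ⁺_{a↑}ψ⁻_{a↑}ψ⁺_{a↓}ψ⁻_{a↓}` in the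
configuration of `n + 2` points (vertices `castAdd 2 a`, external points `natAdd n 0` (creation) and `natAdd n 1`
(annihilation)): pair `0` is the external one, pair `1 + 2a + σ` the spin-`σ` pair of vertex `a`. [folklore] -/
def twoPointPlusEnum (n : ℕ) (σ : Fin 2) : Fin (n * 2 + 1) → Fin (n + 2) × Fin 2 :=
  Fin.cons (Fin.natAdd n (0 : Fin 2), σ) fun m =>
    (Fin.castAdd 2 (finProdFinEquiv.symm m : Fin n × Fin 2).1, (finProdFinEquiv.symm m : Fin n × Fin 2).2)

/-- The enumeration of the UNBARRED legs (pair `0` annihilates at the second external point). [folklore] -/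
def twoPointMinusEnum (n : ℕ) (σ' : Fin 2) : Fin (n * 2 + 1) → Fin (n + 2) × Fin 2 :=
  Fin.cons (Fin.natAdd n (1 : Fin 2), σ') fun m =>
    (Fin.castAdd 2 (finProdFinEquiv.symm m : Fin n × Fin 2).1, (finProdFinEquiv.symm m : Fin n × Fin 2).2)

omit [NeZero L] in
/-- Pair `0` of the barred enumeration. [folklore] -/
@[simp] theorem twoPointPlusEnum_zero (n : ℕ) (σ : Fin 2) : twoPointPlusEnum n σ 0 = (Fin.natAdd n (0 : Fin 2), σ) := rfl

omit [NeZero L] in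
/-- Pair `0` of the unbarred enumeration. [folklore] -/
@[simp] theorem twoPointMinusEnum_zero (n : ℕ) (σ' : Fin 2) :
    twoPointMinusEnum n σ' 0 = (Fin.natAdd n (1 : Fin 2), σ') := rfl

omit [NeZero L] in
/-- The vertex pairs of the barred enumeration. [folklore] -/
@[simp] theorem twoPointPlusEnum_succ (n : ℕ) (σ : Fin 2) (m : Fin (n * 2)) :
    twoPointPlusEnum n σ m.succ =
      (Fin.castAdd 2 (finProdFinEquiv.symm m : Fin n × Fin 2).1, (finProdFinEquiv.symm m : Fin n × Fin 2).2) := by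
  simp [twoPointPlusEnum]

omit [NeZero L] in
/-- The vertex pairs of the unbarred enumeration. [folklore] -/
@[simp] theorem twoPointMinusEnum_succ (n : ℕ) (σ' : Fin 2) (m : Fin (n * 2)) :
    twoPointMinusEnum n σ' m.succ =
      (Fin.castAdd 2 (finProdFinEquiv.symm m : Fin n × Fin 2).1, (finProdFinEquiv.symm m : Fin n × Fin 2).2) := by
  simp [twoPointMinusEnum]

/-- **The two-point moments at finite cutoff are integrated Wick determinants** (BGM 2006, the numerator of (2.8)
expanded in `U`, at cutoff `M`):
`∫dμ_{C_M} ψ⁺_{(x⃗ₑ,sₓ)σ} ψ⁻_{(y⃗ₑ,s_y)σ'} Vⁿ = Uⁿ Σ_{x⃗∈Λⁿ} ∫_{[0,β]ⁿ} det[−(S'ᵀC_MS')((P⁺ i,+),(P⁻ j,−))]_{i,j ≤ 2n} dτ`,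
`S'` the substitution of the configuration `x⃗' = (x⃗, x⃗ₑ, y⃗ₑ)`, `τ' = (τ, sₓ, s_y)`. [cite: BenfattoGiulianiMastropietro2006, §2.1 (2.8)] -/
theorem gaussExpect_twoPoint_mul_hubbardInteraction_pow_eq_det {M : ℕ} {β : ℝ} (hβ : 0 < β) (μ U : ℝ)
    (σ σ' : Fin 2) (xe ye : TorusSite 2 L) (sx sy : ℝ) (n : ℕ) :
    gaussExpect ℂ (hubbardCovariance L M β μ 0)
        (positionField L M β 0 σ xe sx * positionField L M β 1 σ' ye sy * hubbardInteraction L M β U ^ n) =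
      (U : ℂ) ^ n * ∑ x : Fin n → TorusSite 2 L, ∫ τ in Set.Icc (0 : Fin n → ℝ) (fun _ => β),
        (Matrix.of fun i j : Fin (n * 2 + 1) =>
          -((vertexSubMatrix L M β (Fin.append x ![xe, ye]) (Fin.append τ ![sx, sy])).transpose *
              hubbardCovariance L M β μ 0 *
              vertexSubMatrix L M β (Fin.append x ![xe, ye]) (Fin.append τ ![sx, sy]))
            ((twoPointPlusEnum n σ i, 0) : VertexLeg (n + 2)) ((twoPointMinusEnum n σ' j, 1) : VertexLeg (n + 2))).det := by
  -- the fixed linear functional `F ↦ ∫dμ_C (ψ⁺ψ⁻ F)`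
  have key := linearMap_apply_hubbardInteraction_pow (L := L) (M := M) hβ U
    ((gaussExpect ℂ (hubbardCovariance L M β μ 0)).comp
      (LinearMap.mulLeft ℂ (positionField L M β 0 σ xe sx * positionField L M β 1 σ' ye sy))) n
  simp only [LinearMap.comp_apply, LinearMap.mulLeft_apply] at key
  rw [key]
  refine congrArg _ (sum_congr rfl fun x _ => integral_congr_ae (Eventually.of_forall fun τ => ?_))
  simp only
  -- all fields through the substitution of the extended configuration
  set x' : Fin (n + 2) → TorusSite 2 L := Fin.append x ![xe, ye] with hx'
  set τ' : Fin (n + 2) → ℝ := Fin.append τ ![sx, sy] with hτ'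
  have hword : (List.ofFn fun a => vertexFieldWord L M β x τ a).prod =
      (List.ofFn fun a => vertexFieldWord L M β x' τ' (Fin.castAdd 2 a)).prod := by
    congr 1
    refine congrArg List.ofFn (funext fun a => vertexFieldWord_congr β ?_ ?_)
    · rw [hx', Fin.append_left]
    · rw [hτ', Fin.append_left]
  have hplus : positionField L M β 0 σ xe sx =
      ExteriorAlgebra.map (Matrix.toLin' (vertexSubMatrix L M β x' τ'))
        (gen ℂ (((Fin.natAdd n (0 : Fin 2), σ), 0) : VertexLeg (n + 2))) := by
    rw [map_vertexSub_gen_eq_positionField, hx', hτ', Fin.append_right, Fin.append_right]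
    rfl
  have hminus : positionField L M β 1 σ' ye sy =
      ExteriorAlgebra.map (Matrix.toLin' (vertexSubMatrix L M β x' τ'))
        (gen ℂ (((Fin.natAdd n (1 : Fin 2), σ'), 1) : VertexLeg (n + 2))) := by
    rw [map_vertexSub_gen_eq_positionField, hx', hτ', Fin.append_right, Fin.append_right]
    rfl
  rw [hword, prod_vertexFieldWord_comp_eq_map_genPairProd, hplus, hminus, ← map_mul, ← map_mul,
    ← gaussExpect_vertexWord_eq_det β μ x' τ' (twoPointPlusEnum n σ) (twoPointMinusEnum n σ')]
  congr 2
  rw [genPairProd_succ (R := ℂ)]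
  simp only [twoPointPlusEnum_zero, twoPointMinusEnum_zero]
  congr 2

/-- Appending fixed external times is continuous. [folklore] -/
theorem continuous_append_const {n k : ℕ} (v : Fin k → ℝ) :
    Continuous fun τ : Fin n → ℝ => (Fin.append τ v : Fin (n + k) → ℝ) := by
  refine continuous_pi fun i => ?_
  refine Fin.addCases (fun i => ?_) (fun j => ?_) i
  · simp only [Fin.append_left]
    exact continuous_apply i
  · simp only [Fin.append_right]
    exact continuous_const

/-- Off the faces of the time cube, all time differences among the `n` vertex times in `(0, β)` and two external
times in `[0, β)` have modulus `< β`. [folklore] -/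
theorem abs_append_sub_append_lt {n : ℕ} {β : ℝ} {τ : Fin n → ℝ} (hτ : ∀ a, 0 < τ a ∧ τ a < β) {sx sy : ℝ}
    (hsx : sx ∈ Set.Ico 0 β) (hsy : sy ∈ Set.Ico 0 β) (p q : Fin (n + 2)) :
    |(Fin.append τ ![sx, sy] : Fin (n + 2) → ℝ) q - (Fin.append τ ![sx, sy] : Fin (n + 2) → ℝ) p| < β := by
  have hall : ∀ r : Fin (n + 2), 0 ≤ (Fin.append τ ![sx, sy] : Fin (n + 2) → ℝ) r ∧
      (Fin.append τ ![sx, sy] : Fin (n + 2) → ℝ) r < β := by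
    intro r
    refine Fin.addCases (fun i => ?_) (fun j => ?_) r
    · rw [Fin.append_left]; exact ⟨(hτ i).1.le, (hτ i).2⟩
    · rw [Fin.append_right]
      fin_cases j
      · exact ⟨hsx.1, hsx.2⟩
      · exact ⟨hsy.1, hsy.2⟩
  rw [abs_lt]
  constructor <;> linarith [(hall p).1, (hall p).2, (hall q).1, (hall q).2]

/-- **The `M → ∞` limit of the two-point moments**: for `β > 0`, external times `sₓ, s_y ∈ [0, β)` and fixed
`(L, μ, U, n)`, the `n`-th two-point moment converges to
`Uⁿ Σ_{x⃗} ∫_{[0,β]ⁿ} det[vertexLimitEntry(x⃗'_{pᵢ}, x⃗'_{qⱼ}, σᵢ, σⱼ; τ'_{qⱼ} − τ'_{pᵢ})]_{i,j ≤ 2n} dτ`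
(`(pᵢ,σᵢ) = P⁺ i`, `(qⱼ,σⱼ) = P⁻ j`; midpoint values at equal times). [cite: BenfattoGiulianiMastropietro2006, §2.1 (2.8)] -/
theorem tendsto_gaussExpect_twoPoint_mul_hubbardInteraction_pow {β : ℝ} (hβ : 0 < β) (μ U : ℝ) (σ σ' : Fin 2)
    (xe ye : TorusSite 2 L) {sx sy : ℝ} (hsx : sx ∈ Set.Ico 0 β) (hsy : sy ∈ Set.Ico 0 β) (n : ℕ) :
    Tendsto (fun M : ℕ => gaussExpect ℂ (hubbardCovariance L M β μ 0)
        (positionField L M β 0 σ xe sx * positionField L M β 1 σ' ye sy * hubbardInteraction L M β U ^ n)) atTop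
      (𝓝 ((U : ℂ) ^ n * ∑ x : Fin n → TorusSite 2 L, ∫ τ in Set.Icc (0 : Fin n → ℝ) (fun _ => β),
        (Matrix.of fun i j : Fin (n * 2 + 1) =>
          vertexLimitEntry L β μ ((Fin.append x ![xe, ye] : Fin (n + 2) → TorusSite 2 L) (twoPointPlusEnum n σ i).1)
            ((Fin.append x ![xe, ye] : Fin (n + 2) → TorusSite 2 L) (twoPointMinusEnum n σ' j).1)
            (twoPointPlusEnum n σ i).2 (twoPointMinusEnum n σ' j).2
            ((Fin.append τ ![sx, sy] : Fin (n + 2) → ℝ) (twoPointMinusEnum n σ' j).1 -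
              (Fin.append τ ![sx, sy] : Fin (n + 2) → ℝ) (twoPointPlusEnum n σ i).1)).det)) := by
  simp_rw [gaussExpect_twoPoint_mul_hubbardInteraction_pow_eq_det hβ]
  refine (tendsto_finsetSum _ fun x _ => ?_).const_mul _
  refine Literature.Analysis.Matrix.tendsto_setIntegral_det (Literature.Analysis.Matrix.volume_Icc_cube_ne_top β)
    measurableSet_Icc (volume_setOf_exists_apply_mem_pair β) (fun M i j => ?_)
    (B := (1 / (L : ℝ) ^ 2) * ∑ q : TorusSite 2 L, (2 + β * |nambuXi L μ q| / 3)) (fun M τ _ i j => ?_)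
    fun τ hτ hτS i j => ?_
  · simp only [Matrix.of_apply]
    obtain ⟨p, ρ⟩ := twoPointPlusEnum n σ i
    obtain ⟨q, ρ'⟩ := twoPointMinusEnum n σ' j
    exact (continuous_vertexWickEntry hβ.ne' μ (Fin.append x ![xe, ye]) M p q ρ ρ').comp
      (continuous_append_const ![sx, sy])
  · simp only [Matrix.of_apply]
    obtain ⟨p, ρ⟩ := twoPointPlusEnum n σ i
    obtain ⟨q, ρ'⟩ := twoPointMinusEnum n σ' j
    exact norm_vertexWickEntry_le hβ μ (Fin.append x ![xe, ye]) _ M p q ρ ρ'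
  · simp only [Matrix.of_apply]
    have hint : ∀ c, 0 < τ c ∧ τ c < β := by
      intro c
      refine ⟨lt_of_le_of_ne (hτ.1 c) fun h => hτS ⟨c, Or.inl h.symm⟩,
        lt_of_le_of_ne (hτ.2 c) fun h => hτS ⟨c, Or.inr h⟩⟩
    obtain ⟨p, ρ⟩ := twoPointPlusEnum n σ i
    obtain ⟨q, ρ'⟩ := twoPointMinusEnum n σ' j
    exact (tendsto_vertexWickEntry hβ μ (Fin.append x ![xe, ye]) (Fin.append τ ![sx, sy]) p q ρ ρ'
      (abs_append_sub_append_lt hint hsx hsy p q))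

end TwoPoint

end Literature.MathematicalPhysics.QuantumLattice
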